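import Literature.MathematicalPhysics.QuantumFieldTheory.Balaban1983to89.B9Eq3134MatrixConcrete
import Literature.MathematicalPhysics.QuantumFieldTheory.Balaban1983to89.B9SectDSup

/-!
# `Balaban1983to89.B9Eq3138FirstFactors` — T. Bałaban, *Propagators for lattice gauge theories in a background field*, Commun. Math. Phys.
**99** (1985) 389–434 [Balaban1985BackgroundPropagators], Sect. D, p. 423, THE DISPLAYED ESTIMATE AFTER (3.138) («This estimate is given for
first factors in a term»): the three-line bound of `‖ζ∇G₀DRG′D*Δ⁽²⁾Δ(y′)A‖_β` — Theorem 3.3 (3.45) for `G₀` with the derivative `D` absorbed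
into `G₀`, then Theorem 3.1 (3.43)/(3.42) for `RG′D*`, then (3.137) for `Δ⁽²⁾`, the two block decompositions `Σ_{y₁}`, `Σ_{y₁,y₂}` of [4] (2.52)
and the scale transfer `L^{j₁}η ↦ Lʲη` of [4] Lemma 2.1 (2.60) — TYPED AS PRINTED over r16's block-normed spaces (`B11SectG.BlockNorm`/`HasMaj`,
the Hölder sizes abstract) with the `Δ⁽²⁾` FACTOR CONCRETE ([5]'s `C_j⁽²⁾` realised as `𝒞 = calC`, FILE 74 `B9Eq3134MatrixConcrete` §7) —
FILE 77 of the Sect. B–D programme of cell `lit-balaban`, seat r06 (B9 fold owner); rows **B9.Eq3.138** / **B9.Thm3.12** (member cells;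
heads are the lead's word)

statement-level skeleton of published theorems with citation tags; proofs where landed; nothing here is a claim about the Yang–Mills mass gap

DOCFIX v1.1 (seat r06 gen 28, 2026-08-25; referee ref-4 g97 note D-g97-1, zero weight): the quotations of the p. 423 display and of (3.43)/(3.45)
p. 398 now carry print's SCALE SUPERSCRIPTS on the Hölder sizes — `‖ζ‖^ξ_β` (`ξ = L^{−j}`), `‖λ‖^{ξ′}_{β+ε}` (`ξ′ = L^{−j′}`), and `‖ζ_{Δ̃(y₁)}…‖^{ξ₁}_{β+ε}`
in the p. 423 display (renders p035-x4 / p010-x4 re-read as images) — which v1 omitted. Content unaffected (the sizes are abstract letters inside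
`bP`, `bH`). Declarations, statements and proofs are byte-identical to the tree copy of record (p382874, sha16 191e910dd2feed29).

CITATION HEADER (lean-in-tree rule).  B9 = [Balaban1985BackgroundPropagators] (held `paper:balaban1985-cmp99-background-propagators`, journal
page = PDF page + 388; render `b2b-balaban-ref1/pages/1985-cmp99-background-propagators/…-p035-x2.png` READ AS AN IMAGE by this seat
2026-08-24 — the text layer p0035 does not carry the display).  p. 423 [PDF 35], after (3.138): «Estimates of the terms in this series are now a
little bit more complicated. It is connected with the fact that we have derivatives in the operator Δ′_π + Δ⁽²⁾_π which have to be applied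
either to the operator on the right, or on the left, because kernels of the operators defining Δ_π + Δ⁽²⁾_π are not regular enough.
‖ζ∇G₀DRG′D\*Δ⁽²⁾Δ(y′)A‖_β ≦ Σ_{y₁} B′₀(ε,β)(Lʲη)^{−β}(‖ζ‖^ξ_β + |ζ|)·e^{−δ₀d(y,y₁)}(‖ζ_{Δ̃(y₁)}RG′D\*Δ⁽²⁾Δ(y′)A‖^{ξ₁}_{β+ε} + |ζ_{Δ̃(y₁)}RG′D\*Δ⁽²⁾Δ(y′)A|)
 ≦ Σ_{y₁,y₂} B′₀(ε,β)(Lʲη)^{−β}(‖ζ‖^ξ_β + |ζ|)·e^{−δ₀d(y,y₁)}B₀(β + ε)L^{j₁}η(‖ζ_{Δ̃(y₁)}‖^{ξ₁}_{β+ε} + |ζ_{Δ̃(y₁)}|)e^{−δ₀d(y₁,y₂)}|Δ(y₂)Δ⁽²⁾Δ(y′)A|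
 ≦ B′₀(ε,β)B₀(β + ε)(Lʲη)^{1−β}(‖ζ‖^ξ_β + |ζ|)e^{−(1−α)δ₀d(y,y′)}O(1)Mα₀(L^{j′}η)^{−2}|A|,
the supremum |A| is taken over several j′-blocks surrounding Δ(y′). This estimate is given for first factors in a term, the remaining factors
are easier to estimate, following the above pattern. Let us notice that constants O(1) we get depend only on B₀(ε) with ε properly chosen
(e.g. ε = 1/2), so they are absolute constants depending on d and L only, and the series (3.138) is convergent for α₀ restricted by a small,
absolute constant. The convergence is in all norms appearing in the formulation of Theorem 3.3. This implies that the theorem is valid for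
G₁.»  The letters print names (render p010 re-read): Theorem 3.1/3.3 (3.45) p. 398 «‖ζ∇_UG′(U)∇\*_Uλ‖_β ≦ B′₀(ε,β₀)(Lʲη)^{−β}(‖ζ‖^ξ_β +
|ζ|)e^{−δ₀d(y,y′)}(‖λ‖^{ξ′}_{β+ε} + |λ|) … ξ = L^{−j}, supp λ ⊂ Δ̃(y), y′ ∈ Λ_{j′}, ξ′ = L^{−j′}», (3.43) p. 398 «‖ζ∇_UG′(U)λ‖_β,
‖ζG′(U)∇\*_Uλ‖_β ≦ B₀(β₀)(Lʲη)^{1−β}(‖ζ‖^ξ_β + |ζ|)e^{−δ₀d(y,y′)}|λ|, ξ = L^{−j}», p. 398 «the choice of derivatives ∇_U, ∇\*_U is conventional … Using Lemma 2.1 in [4] we may replace the factor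
(Lʲη)^α by (Lʲη)^β(L^{j′}η)^γ with β + γ = α, j, j′ are indices of localizations»; (3.137) p. 423 «|(Δ⁽²⁾A)(b)| ≦ O(1)Mα₀(Lʲη)⁻²|A|,
b∈Δ(y), y∈Λ_j».  [4] = [Balaban1984PropagatorsII] (2.52)–(2.55) p. 232 (the block decomposition — our paraphrase: insert Σ_yΔ(y) = I between
the factors — and the triangle inequality (2.54)), Lemma 2.1 (2.60)–(2.61) p. 234.

WHAT IS PROVED (kernel; theorems only — 0 `def`, 0 named fact, 0 sorry).  Three block-normed spaces on one `B6.Geometry` (𝔅 = `g.Site`,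
`g.len y = Lʲη`, `g.dist`): `bA` on the bond configurations `FA` (print: the sup sizes `|Δ(y₂)·|`), `bP` on an intermediate space `P` (print:
the sizes `‖ζ_{Δ̃(y₁)}·‖_{β+ε} + |ζ_{Δ̃(y₁)}·|`, the cut-offs `ζ_{Δ̃(y₁)}` being `bP.cut` with cost `κ_P`), `bH` on a target `H` (print: the sizes
`‖ζ∇·‖_β` normalised by `‖ζ‖_β + |ζ|`).  Letters (hypotheses of the printed exponential shape, each the object of another row): `GzD : P → H`
(print `ζ∇G₀D`) with majorant `B′·w(y)·e^{−δ₁d(y,y₁)}` — (3.45) for `G₀`, `w(y) = (Lʲη)^{−β}`, `B′ = B′₀(ε,β)`; `RGDs : FA → P` (print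
`RG′D\*`) with `B₁·(L^{j₁}η)·e^{−δ₁d(y₁,y₂)}` — (3.43)/(3.42)₃ for `G′` after `R`, `B₁ = B₀(β+ε)`; `Δ2 : FA → FA` with `θ·v(y′)·e^{−δ₁d(y₂,y′)}`
— (3.137), `θ = O(1)Mα₀`, `v(y′) = (L^{j′}η)^{−2}`.
* §1 (generic [4] bookkeeping) `hasMaj_comp_exp_weighted` — composition (2.52)/(2.55) with prefactors depending on the OUTER variables
  (`u(y)`, `v(y′)` factor out of the `Σ_{y″}` of (2.52)); **`hasMaj_comp_exp_transfer`** — the same when the inner kernel carries the scale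
  weight `L^{j″}η` of its left variable: [4] (2.60) `L^{j″}η ≦ L·Lʲη·e^{αδ₀d(y,y″)}` (`B9SectDL2Decay.len_pow_le_of_ineq260`, under `log L ≦ αδ₀RM`)
  moves it onto the outer variable at the cost `L` and the rate `αδ₀` — the p. 398 remark in the form print uses it here.
* §2 THE DISPLAY: `line1` (first `≦`: the letter (3.45) through the partition of unity of `P`, `HasMaj.bound`), `line2` (second `≦`: the two
  letters composed, `Σ_{y₁,y₂}`), **`firstFactors`** (third `≦`, as a majorant of the composite `ζ∇G₀D ∘ RG′D\* ∘ Δ⁽²⁾` from `bA` to `bH`):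
  `[κ_Pκ_A·L·c²·B′B₁θ]·w(y)·(Lʲη)·v(y′)·e^{−ρd(y,y′)}` for every `ρ ≧ 0` with `ρ + 2σ + αδ₀ ≦ δ₁` (`σ` = the rate spent on each row sum
  (2.61), constant `c`) — print: `B′₀B₀(Lʲη)^{1−β}·O(1)Mα₀(L^{j′}η)^{−2}·e^{−(1−α)δ₀d(y,y′)}`; `line3` (the same read on `Δ(y′)A`).
* §3 **`firstFactors_concrete`** — the display WITH THE `Δ⁽²⁾` FACTOR CONCRETE: `bA` = the sharp-block sup sizes `BlockNorm.ofBlocks g blk` on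
  the real coordinates `S × ι → ℝ` of FILE 74, `Δ2 = mulVecLin (delta2 calC)` (p10's `B9Delta2Def134.delta2` of the realised matrix `𝒞`), its
  majorant `θ_Δe^{δ₁R}e^{−δ₁d}` being FILE 74's `B9Eq3134MatrixConcrete.hasMaj_delta2_calC_exp` (θ_Δ = [2dC₃‖τ‖(Σ_i‖e_i‖)M_e c₀·#lv]·(Mα₀) =
  `O(1)·Mα₀`; regime of `B7Eq136SecondOrder` verbatim, budget `w_j(c)‖K_j(c)‖ ≦ c₀Mα₀(Lʲ)^{d−2}`, box range `R`).

HONEST SCOPE / NOT CLAIMED.  (i) The letters `ζ∇G₀D` ((3.45) for `G₀` = Theorem 3.3, row B9.Thm3.3) and `RG′D\*` ((3.43)/(3.42)₃ for `G′` =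
Theorem 3.1 with `R = I − P` of (3.49), rows B9.Thm3.1 / B9.Eq3.49) are HYPOTHESES of the printed shape between ABSTRACT block norms; the
Hölder sizes `‖·‖^ξ_β` (scale superscripts `ξ = L^{−j}`, `ξ₁`, `ξ′` as printed), the cut-offs `ζ`, `ζ_{Δ̃(y₁)}` and the normalisation by `‖ζ‖^ξ_β + |ζ|` live inside `bP`, `bH`, `w` and are not modelled
(as in `B9SectDSup`, whose factored bookkeeping this display feeds).  (ii) In §3 only the `Δ⁽²⁾` factor is discharged; print's weight
`(L^{j′}η)^{−2}` of (3.137) is absorbed in FILE 74's flat-carrier units (`v ≡ 1` there; located in FILE 74 (iii)/(vi) and the lead's note (b) of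
Q-B9-26-3), and the flat carrier's block-spin factor `L : ℕ` is not identified with the geometry's `g.L`.  (iii) Rates are explicit: with all
three letters at one rate `δ₁` the conclusion holds at every `ρ ≧ 0` with `ρ + 2σ + αδ₀ ≦ δ₁` — print's `(1 − α)δ₀` absorbs the two row sums
into `α` (cell GAPS G-B9-r06-2 pattern; no claim either way).  (iv) «the remaining factors are easier to estimate, following the above pattern»,
the convergence of (3.138) «in all norms» and Theorem 3.12 itself are NOT treated here (`B9SectDSup`/`B9SectDL2Decay`/`B9Delta2PiMajorant
.series3138_rightEntry` by reference).  (v) LOCATED (zero weight, for FILE 76's readers): print never bounds the dressing `DRG′D\*` as a sup → sup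
operator — its outer `D` is absorbed into the neighbouring `G₀` exactly as displayed here; FILE 76's hypotheses `hP`/`hPt` (sup-block majorants
of `1 − T`, `1 − Tᵀ`) hold on every finite lattice but their constants are not the print's `O(1)`; the printed route for the dressed summands
of (3.135) inside (3.138) is this file's.  Constants explicit, unoptimised.  NOT summit progress.

RELATED IN THE TREE, NOT DUPLICATED (searched 2026-08-24: stems `*3138*`, `*FirstFactor*`, `*Delta2*` in `Balaban1983to89/`; `B4Eq218FirstFactor` is
[B4]'s unrelated (2.18)): `B9SectDSup` (product/weight norms, `HasMaj.transfer` for ℕ-powers with the ratio inside the kernel — here the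
single power sits on the summation variable, whence §1), `B9SectDL2Decay.len_pow_le_of_ineq260` (USED), r16 `B11SectG` (`hasMaj_comp`,
`conv_exp_le`, `HasMaj.bound` — USED), FILE 74 `B9Eq3134MatrixConcrete.hasMaj_delta2_calC_exp` (USED), FILE 76 `B9Delta2PiMajorant` (the
dressing algebra at the sup level; see (v)).  Unit `lit-balaban-r06`, HOME `run/shared/lean/pub/lit-balaban/`.
-/

noncomputable section

open scoped BigOperators Matrix

namespace Literature.MathematicalPhysics.QuantumFieldTheory.Balaban1983to89.B9Eq3138FirstFactors

open Literature.MathematicalPhysics.QuantumFieldTheory.Balaban1983to89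
open B11SectG B6RandomWalk

/-! ## §1 [4] (2.52)–(2.55) with prefactors on the outer variables, and with the scale transfer (2.60) on the summation variable -/

section Generic

variable {g : B6.Geometry} {F₁ F₂ F₃ : Type} [AddCommGroup F₁] [Module ℝ F₁] [AddCommGroup F₂] [Module ℝ F₂]
  [AddCommGroup F₃] [Module ℝ F₃]

/-- **composition with prefactors depending on the outer variables**: `T₁` with majorant `u(y)e^{−ρ₁d(y,y″)}` after `T₂` with
`v(y′)e^{−ρ₂d(y″,y′)}` has `κ₂·u(y)·v(y′)·c·e^{−ρd(y,y′)}` for `0 ≦ ρ ≦ ρ₂`, `ρ + σ ≦ ρ₁` — [4] (2.52) (insert the partition of unity of the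
middle space), (2.54) and the row sum (2.61) at the rate `σ`; `u(y)`, `v(y′)` factor out of the sum over `y″`.
[cite: Balaban1984PropagatorsII, (2.52)–(2.55) p.232, (2.61) p.234] -/
theorem hasMaj_comp_exp_weighted {b₁ : BlockNorm g F₁} {b₂ : BlockNorm g F₂} {b₃ : BlockNorm g F₃}
    {T₁ : F₂ →ₗ[ℝ] F₃} {T₂ : F₁ →ₗ[ℝ] F₂} (u v : g.Site → ℝ) {ρ₁ ρ₂ ρ σ c : ℝ}
    (htri : Triangle254 g) (hd : ∀ a b : g.Site, 0 ≤ g.dist a b) (hrow : RowSum g σ c)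
    (hu : ∀ y, 0 ≤ u y) (hv : ∀ y, 0 ≤ v y) (hρ : 0 ≤ ρ) (hρ₂ : ρ ≤ ρ₂) (hρ₁ : ρ + σ ≤ ρ₁)
    (h₁ : HasMaj b₂ b₃ T₁ (fun y y'' => u y * Real.exp (-(ρ₁ * g.dist y y''))))
    (h₂ : HasMaj b₁ b₂ T₂ (fun y'' y' => v y' * Real.exp (-(ρ₂ * g.dist y'' y')))) :
    HasMaj b₁ b₃ (T₁ ∘ₗ T₂) (fun y y' => b₂.κ * u y * v y' * c * Real.exp (-(ρ * g.dist y y'))) := by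
  refine (hasMaj_comp h₁ h₂ fun a b => mul_nonneg (hu a) (Real.exp_nonneg _)).mono fun a b => ?_
  have hconv := conv_exp_le htri hd hrow hρ hρ₂ hρ₁ a b
  calc ∑ y'' : g.Site, u a * Real.exp (-(ρ₁ * g.dist a y'')) * (b₂.κ * (v b * Real.exp (-(ρ₂ * g.dist y'' b))))
      = b₂.κ * u a * v b *
          ∑ y'' : g.Site, Real.exp (-(ρ₁ * g.dist a y'')) * Real.exp (-(ρ₂ * g.dist y'' b)) := by
        rw [Finset.mul_sum]; exact Finset.sum_congr rfl fun y'' _ => by ring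
    _ ≤ b₂.κ * u a * v b * (c * Real.exp (-(ρ * g.dist a b))) :=
        mul_le_mul_of_nonneg_left hconv (mul_nonneg (mul_nonneg b₂.κ_nonneg (hu a)) (hv b))
    _ = _ := by ring

/-- **composition with the scale weight `L^{j″}η` on the summation variable** — the step from the second to the third line of the p. 423
display: `T₁` with `u(y)e^{−ρ₁d(y,y″)}` after `T₂` with `(L^{j″}η)·v(y′)·e^{−ρ₂d(y″,y′)}` has `κ₂·L·u(y)·(Lʲη)·v(y′)·c·e^{−ρd(y,y′)}` for
`0 ≦ ρ ≦ ρ₂`, `ρ + σ + αδ₀ ≦ ρ₁`: [4] (2.60) in the form `L^{j″}η ≦ L·Lʲη·e^{αδ₀d(y,y″)}` (`B9SectDL2Decay.len_pow_le_of_ineq260` with `t = 1`,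
under `log L ≦ αδ₀RM`) moves the weight onto `y` — «Using Lemma 2.1 in [4] we may replace the factor (Lʲη)^α by (Lʲη)^β(L^{j′}η)^γ» — then
(2.54) + (2.61). [cite: Balaban1985BackgroundPropagators, p.423 (display after (3.138)), p.398 (remark after (3.47))]
[cite: Balaban1984PropagatorsII, (2.52)–(2.55) p.232, Lemma 2.1 (2.60)–(2.61) p.234] -/
theorem hasMaj_comp_exp_transfer {b₁ : BlockNorm g F₁} {b₂ : BlockNorm g F₂} {b₃ : BlockNorm g F₃}
    {T₁ : F₂ →ₗ[ℝ] F₃} {T₂ : F₁ →ₗ[ℝ] F₂} (u v : g.Site → ℝ) {δ₀ α ρ₁ ρ₂ ρ σ c : ℝ}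
    (htri : Triangle254 g) (hd : ∀ a b : g.Site, 0 ≤ g.dist a b) (hrow : RowSum g σ c)
    (h260 : Ineq260 g δ₀ α) (hαδ : 0 ≤ α * δ₀) (hL : 1 ≤ g.L) (hη : 0 < g.eta)
    (hRM : Real.log g.L ≤ α * δ₀ * g.R * g.M)
    (hu : ∀ y, 0 ≤ u y) (hv : ∀ y, 0 ≤ v y) (hρ : 0 ≤ ρ) (hρ₂ : ρ ≤ ρ₂) (hρ₁ : ρ + σ + α * δ₀ ≤ ρ₁)
    (h₁ : HasMaj b₂ b₃ T₁ (fun y y'' => u y * Real.exp (-(ρ₁ * g.dist y y''))))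
    (h₂ : HasMaj b₁ b₂ T₂ (fun y'' y' => g.len y'' * v y' * Real.exp (-(ρ₂ * g.dist y'' y')))) :
    HasMaj b₁ b₃ (T₁ ∘ₗ T₂)
      (fun y y' => b₂.κ * g.L * u y * g.len y * v y' * c * Real.exp (-(ρ * g.dist y y'))) := by
  have hL0 : 0 ≤ g.L := zero_le_one.trans hL
  refine (hasMaj_comp h₁ h₂ fun a b => mul_nonneg (hu a) (Real.exp_nonneg _)).mono fun a b => ?_
  -- (2.60): `L^{j″}η ≤ L · Lʲη · e^{αδ₀ d(y,y″)}`, termwise under the sum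
  have hterm : ∀ y'' : g.Site,
      u a * Real.exp (-(ρ₁ * g.dist a y'')) * (b₂.κ * (g.len y'' * v b * Real.exp (-(ρ₂ * g.dist y'' b)))) ≤
        b₂.κ * g.L * u a * g.len a * v b *
          (Real.exp (-((ρ₁ - α * δ₀) * g.dist a y'')) * Real.exp (-(ρ₂ * g.dist y'' b))) := by
    intro y''
    have ht := B9SectDL2Decay.len_pow_le_of_ineq260 h260 hαδ hd hL hη.le 1 (by simpa using hRM) a y''
    simp only [pow_one] at ht
    have hfac : 0 ≤ u a * Real.exp (-(ρ₁ * g.dist a y'')) * b₂.κ * (v b * Real.exp (-(ρ₂ * g.dist y'' b))) :=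
      mul_nonneg (mul_nonneg (mul_nonneg (hu a) (Real.exp_nonneg _)) b₂.κ_nonneg) (mul_nonneg (hv b) (Real.exp_nonneg _))
    calc u a * Real.exp (-(ρ₁ * g.dist a y'')) * (b₂.κ * (g.len y'' * v b * Real.exp (-(ρ₂ * g.dist y'' b))))
        = u a * Real.exp (-(ρ₁ * g.dist a y'')) * b₂.κ * (v b * Real.exp (-(ρ₂ * g.dist y'' b))) * g.len y'' := by ring
      _ ≤ u a * Real.exp (-(ρ₁ * g.dist a y'')) * b₂.κ * (v b * Real.exp (-(ρ₂ * g.dist y'' b))) *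
            (g.L * g.len a * Real.exp (α * δ₀ * g.dist a y'')) := mul_le_mul_of_nonneg_left ht hfac
      _ = b₂.κ * g.L * u a * g.len a * v b *
            ((Real.exp (α * δ₀ * g.dist a y'') * Real.exp (-(ρ₁ * g.dist a y''))) * Real.exp (-(ρ₂ * g.dist y'' b))) := by
          ring
      _ = _ := by
          rw [← Real.exp_add, show α * δ₀ * g.dist a y'' + -(ρ₁ * g.dist a y'') = -((ρ₁ - α * δ₀) * g.dist a y'') by ring]
  have hconv := conv_exp_le (ρ₁ := ρ₁ - α * δ₀) htri hd hrow hρ hρ₂ (by linarith) a b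
  have hpre : 0 ≤ b₂.κ * g.L * u a * g.len a * v b := by
    have hlen : 0 ≤ g.len a := by
      rw [B6.Geometry.len]; exact mul_nonneg (pow_nonneg hL0 _) hη.le
    exact mul_nonneg (mul_nonneg (mul_nonneg (mul_nonneg b₂.κ_nonneg hL0) (hu a)) hlen) (hv b)
  calc ∑ y'' : g.Site, u a * Real.exp (-(ρ₁ * g.dist a y'')) * (b₂.κ * (g.len y'' * v b * Real.exp (-(ρ₂ * g.dist y'' b))))
      ≤ ∑ y'' : g.Site, b₂.κ * g.L * u a * g.len a * v b *
          (Real.exp (-((ρ₁ - α * δ₀) * g.dist a y'')) * Real.exp (-(ρ₂ * g.dist y'' b))) := Finset.sum_le_sum fun y'' _ => hterm y''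
    _ = b₂.κ * g.L * u a * g.len a * v b *
          ∑ y'' : g.Site, Real.exp (-((ρ₁ - α * δ₀) * g.dist a y'')) * Real.exp (-(ρ₂ * g.dist y'' b)) := by
        rw [Finset.mul_sum]
    _ ≤ b₂.κ * g.L * u a * g.len a * v b * (c * Real.exp (-(ρ * g.dist a b))) := mul_le_mul_of_nonneg_left hconv hpre
    _ = _ := by ring

end Generic

/-! ## §2 The p. 423 display: `ζ∇G₀D ∘ RG′D* ∘ Δ⁽²⁾` through `Σ_{y₁}`, `Σ_{y₁,y₂}` and (2.60) -/

section Display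

variable {g : B6.Geometry} {FA P H : Type} [AddCommGroup FA] [Module ℝ FA] [AddCommGroup P] [Module ℝ P]
  [AddCommGroup H] [Module ℝ H]
variable {bA : BlockNorm g FA} {bP : BlockNorm g P} {bH : BlockNorm g H}
variable {Δ2 : Module.End ℝ FA} {RGDs : FA →ₗ[ℝ] P} {GzD : P →ₗ[ℝ] H}
variable {w v : g.Site → ℝ} {B' B₁ θ δ₁ : ℝ}

/-- **line 1** (the first `≦` of the display): the letter (3.45) for `G₀` — «‖ζ∇G₀D f‖_β ≦ Σ_{y₁} B′₀(ε,β)(Lʲη)^{−β}(‖ζ‖^ξ_β + |ζ|)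
e^{−δ₀d(y,y₁)}(‖ζ_{Δ̃(y₁)}f‖^{ξ₁}_{β+ε} + |ζ_{Δ̃(y₁)}f|)» for `f = RG′D\*Δ⁽²⁾Δ(y′)A` — is the majorant `B′w(y)e^{−δ₁d(y,y₁)}` of `GzD : bP → bH` read
through the partition of unity `Σ_{y₁}ζ_{Δ̃(y₁)}` of `P` (`bP.cut`, cost `κ_P`). [cite: Balaban1985BackgroundPropagators, p.423 (display after
(3.138)), (3.45) p.398] [cite: Balaban1984PropagatorsII, (2.52)–(2.53) p.232] -/
theorem line1 (hB' : 0 ≤ B') (hw : ∀ y, 0 ≤ w y)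
    (hGD : HasMaj bP bH GzD (fun y y₁ => B' * w y * Real.exp (-(δ₁ * g.dist y y₁)))) (f : P) (y : g.Site) :
    bH.loc y (GzD f) ≤ ∑ y₁ : g.Site, B' * w y * Real.exp (-(δ₁ * g.dist y y₁)) * (bP.κ * bP.loc y₁ f) :=
  hGD.bound (fun a _ => mul_nonneg (mul_nonneg hB' (hw a)) (Real.exp_nonneg _)) f y

/-- **line 2** (the second `≦`): the letter (3.43)/(3.42)₃ for `RG′D\*` — «B₀(β + ε)L^{j₁}η(‖ζ_{Δ̃(y₁)}‖^{ξ₁}_{β+ε} + |ζ_{Δ̃(y₁)}|)e^{−δ₀d(y₁,y₂)}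
|Δ(y₂)·|» — inserted under the `Σ_{y₁}` of line 1 with the second block decomposition `Σ_{y₂}Δ(y₂) = I` of `FA` (cost `κ_A`), read on
`F = Δ⁽²⁾Δ(y′)A`: `‖ζ∇G₀DRG′D\*F‖ ≦ Σ_{y₂}Σ_{y₁} B′w(y)e^{−δ₁d(y,y₁)}·κ_P·B₁(L^{j₁}η)e^{−δ₁d(y₁,y₂)}·κ_A|Δ(y₂)F|`.
[cite: Balaban1985BackgroundPropagators, p.423 (display after (3.138)), (3.43) p.398] [cite: Balaban1984PropagatorsII, (2.52)–(2.55) p.232] -/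
theorem line2 (hB' : 0 ≤ B') (hB₁ : 0 ≤ B₁) (hw : ∀ y, 0 ≤ w y) (hL : 1 ≤ g.L) (hη : 0 < g.eta)
    (hGD : HasMaj bP bH GzD (fun y y₁ => B' * w y * Real.exp (-(δ₁ * g.dist y y₁))))
    (hRG : HasMaj bA bP RGDs (fun y₁ y₂ => B₁ * g.len y₁ * Real.exp (-(δ₁ * g.dist y₁ y₂)))) (F : FA) (y : g.Site) :
    bH.loc y (GzD (RGDs F)) ≤
      ∑ y₂ : g.Site, (∑ y₁ : g.Site, B' * w y * Real.exp (-(δ₁ * g.dist y y₁)) *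
        (bP.κ * (B₁ * g.len y₁ * Real.exp (-(δ₁ * g.dist y₁ y₂))))) * (bA.κ * bA.loc y₂ F) := by
  have hlen : ∀ z : g.Site, 0 ≤ g.len z := fun z => by
    rw [B6.Geometry.len]; exact mul_nonneg (pow_nonneg (zero_le_one.trans hL) _) hη.le
  have h12 := hasMaj_comp hGD hRG fun a _ => mul_nonneg (mul_nonneg hB' (hw a)) (Real.exp_nonneg _)
  have := h12.bound (fun a b => Finset.sum_nonneg fun y₁ _ =>
    mul_nonneg (mul_nonneg (mul_nonneg hB' (hw a)) (Real.exp_nonneg _))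
      (mul_nonneg bP.κ_nonneg (mul_nonneg (mul_nonneg hB₁ (hlen y₁)) (Real.exp_nonneg _)))) F y
  simpa only [LinearMap.comp_apply] using this

/-- **THE FIRST FACTORS OF A TERM OF (3.138)** (the third `≦` of the display, as a block majorant): with `ζ∇G₀D : bP → bH` bounded by
`B′w(y)e^{−δ₁d}` ((3.45) for `G₀`), `RG′D\* : bA → bP` by `B₁(L^{j₁}η)e^{−δ₁d}` ((3.43)/(3.42)₃ for `G′` after `R`) and `Δ⁽²⁾ : bA → bA` by
`θv(y′)e^{−δ₁d}` ((3.137)), the composite `ζ∇G₀DRG′D\*Δ⁽²⁾` has the majorant `[κ_Pκ_A·L·c²·B′B₁θ]·w(y)(Lʲη)v(y′)·e^{−ρd(y,y′)}` for every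
`ρ ≧ 0` with `ρ + 2σ + αδ₀ ≦ δ₁` — print: `B′₀(ε,β)B₀(β+ε)(Lʲη)^{1−β}(‖ζ‖_β + |ζ|)e^{−(1−α)δ₀d(y,y′)}O(1)Mα₀(L^{j′}η)^{−2}` (`w(y) = (Lʲη)^{−β}`,
`v(y′) = (L^{j′}η)^{−2}`, `θ = O(1)Mα₀`).  Two compositions [4] (2.52)–(2.55) with the row sum (2.61) at the rate `σ` each, and ONE transfer
(2.60) `L^{j₁}η ↦ L·Lʲη` at the rate `αδ₀` (`hasMaj_comp_exp_transfer`). [cite: Balaban1985BackgroundPropagators, p.423 (display after (3.138)),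
(3.43)/(3.45) p.398, (3.137) p.423] [cite: Balaban1984PropagatorsII, (2.52)–(2.55) p.232, Lemma 2.1 (2.60)–(2.61) p.234] -/
theorem firstFactors {δ₀ α ρ σ c : ℝ}
    (htri : Triangle254 g) (hd : ∀ a b : g.Site, 0 ≤ g.dist a b) (hrow : RowSum g σ c) (hc : 0 ≤ c)
    (h260 : Ineq260 g δ₀ α) (hαδ : 0 ≤ α * δ₀) (hL : 1 ≤ g.L) (hη : 0 < g.eta) (hRM : Real.log g.L ≤ α * δ₀ * g.R * g.M)
    (hB' : 0 ≤ B') (hB₁ : 0 ≤ B₁) (hθ : 0 ≤ θ) (hw : ∀ y, 0 ≤ w y) (hv : ∀ y, 0 ≤ v y)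
    (hρ : 0 ≤ ρ) (hσ : 0 ≤ σ) (hρδ : ρ + 2 * σ + α * δ₀ ≤ δ₁)
    (hGD : HasMaj bP bH GzD (fun y y₁ => B' * w y * Real.exp (-(δ₁ * g.dist y y₁))))
    (hRG : HasMaj bA bP RGDs (fun y₁ y₂ => B₁ * g.len y₁ * Real.exp (-(δ₁ * g.dist y₁ y₂))))
    (hΔ : HasMaj bA bA Δ2 (fun y₂ y' => θ * v y' * Real.exp (-(δ₁ * g.dist y₂ y')))) :
    HasMaj bA bH (GzD ∘ₗ (RGDs ∘ₗ Δ2))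
      (fun y y' => (bP.κ * bA.κ * g.L * c ^ 2 * (B' * B₁ * θ)) * (w y * g.len y * v y') *
        Real.exp (-(ρ * g.dist y y'))) := by
  have hlen : ∀ z : g.Site, 0 ≤ g.len z := fun z => by
    rw [B6.Geometry.len]; exact mul_nonneg (pow_nonneg (zero_le_one.trans hL) _) hη.le
  -- step A: `RG′D* ∘ Δ⁽²⁾ : bA → bP` at the rate `ρ + σ + αδ₀`
  have hA : HasMaj bA bP (RGDs ∘ₗ Δ2)
      (fun y₁ y' => bA.κ * (B₁ * g.len y₁) * (θ * v y') * c * Real.exp (-((ρ + σ + α * δ₀) * g.dist y₁ y'))) :=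
    hasMaj_comp_exp_weighted (fun y₁ => B₁ * g.len y₁) (fun y' => θ * v y') htri hd hrow
      (fun y₁ => mul_nonneg hB₁ (hlen y₁)) (fun y' => mul_nonneg hθ (hv y')) (by linarith) (by linarith) (by linarith) hRG hΔ
  have hA' : HasMaj bA bP (RGDs ∘ₗ Δ2)
      (fun y₁ y' => g.len y₁ * (bA.κ * B₁ * θ * c * v y') * Real.exp (-((ρ + σ + α * δ₀) * g.dist y₁ y'))) :=
    hA.mono fun y₁ y' => le_of_eq (by ring)
  -- step B: `ζ∇G₀D ∘ (RG′D* ∘ Δ⁽²⁾)` with the transfer of `L^{j₁}η`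
  have hB := hasMaj_comp_exp_transfer (fun y => B' * w y) (fun y' => bA.κ * B₁ * θ * c * v y') htri hd hrow h260 hαδ hL hη hRM
    (fun y => mul_nonneg hB' (hw y))
    (fun y' => mul_nonneg (mul_nonneg (mul_nonneg (mul_nonneg bA.κ_nonneg hB₁) hθ) hc) (hv y'))
    hρ (show ρ ≤ ρ + σ + α * δ₀ by linarith) (show ρ + σ + α * δ₀ ≤ δ₁ by linarith) hGD hA'
  exact hB.mono fun y y' => le_of_eq (by ring)

/-- **line 3 read on `Δ(y′)A`** («≦ B′₀(ε,β)B₀(β+ε)(Lʲη)^{1−β}(…)e^{−(1−α)δ₀d(y,y′)}O(1)Mα₀(L^{j′}η)^{−2}|A|, the supremum |A| is taken over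
several j′-blocks surrounding Δ(y′)»): for every `A` and every block `y′`, the size near `y` of `ζ∇G₀DRG′D\*Δ⁽²⁾Δ(y′)A` is at most the
`firstFactors` kernel at `(y,y′)` times `κ_A|A|` near `y′` (`Δ(y′) = bA.cut y′`). [cite: Balaban1985BackgroundPropagators, p.423 (display
after (3.138))] [cite: Balaban1984PropagatorsII, (2.51)–(2.52) p.232] -/
theorem line3 {δ₀ α ρ σ c : ℝ}
    (htri : Triangle254 g) (hd : ∀ a b : g.Site, 0 ≤ g.dist a b) (hrow : RowSum g σ c) (hc : 0 ≤ c)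
    (h260 : Ineq260 g δ₀ α) (hαδ : 0 ≤ α * δ₀) (hL : 1 ≤ g.L) (hη : 0 < g.eta) (hRM : Real.log g.L ≤ α * δ₀ * g.R * g.M)
    (hB' : 0 ≤ B') (hB₁ : 0 ≤ B₁) (hθ : 0 ≤ θ) (hw : ∀ y, 0 ≤ w y) (hv : ∀ y, 0 ≤ v y)
    (hρ : 0 ≤ ρ) (hσ : 0 ≤ σ) (hρδ : ρ + 2 * σ + α * δ₀ ≤ δ₁)
    (hGD : HasMaj bP bH GzD (fun y y₁ => B' * w y * Real.exp (-(δ₁ * g.dist y y₁))))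
    (hRG : HasMaj bA bP RGDs (fun y₁ y₂ => B₁ * g.len y₁ * Real.exp (-(δ₁ * g.dist y₁ y₂))))
    (hΔ : HasMaj bA bA Δ2 (fun y₂ y' => θ * v y' * Real.exp (-(δ₁ * g.dist y₂ y')))) (A : FA) (y y' : g.Site) :
    bH.loc y (GzD (RGDs (Δ2 (bA.cut y' A)))) ≤
      (bP.κ * bA.κ * g.L * c ^ 2 * (B' * B₁ * θ)) * (w y * g.len y * v y') * Real.exp (-(ρ * g.dist y y')) *
        (bA.κ * bA.loc y' A) := by
  have h := firstFactors htri hd hrow hc h260 hαδ hL hη hRM hB' hB₁ hθ hw hv hρ hσ hρδ hGD hRG hΔ y' (bA.cut y' A)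
    (bA.isLoc_cut y' A) y
  simp only [LinearMap.comp_apply] at h
  have hlen : 0 ≤ g.len y := by
    rw [B6.Geometry.len]; exact mul_nonneg (pow_nonneg (zero_le_one.trans hL) _) hη.le
  have hC : 0 ≤ bP.κ * bA.κ * g.L * c ^ 2 * (B' * B₁ * θ) :=
    mul_nonneg (mul_nonneg (mul_nonneg (mul_nonneg bP.κ_nonneg bA.κ_nonneg) (zero_le_one.trans hL)) (sq_nonneg c))
      (mul_nonneg (mul_nonneg hB' hB₁) hθ)
  have hK : 0 ≤ (bP.κ * bA.κ * g.L * c ^ 2 * (B' * B₁ * θ)) * (w y * g.len y * v y') * Real.exp (-(ρ * g.dist y y')) :=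
    mul_nonneg (mul_nonneg hC (mul_nonneg (mul_nonneg (hw y) hlen) (hv y'))) (Real.exp_nonneg _)
  calc bH.loc y (GzD (RGDs (Δ2 (bA.cut y' A))))
      ≤ (bP.κ * bA.κ * g.L * c ^ 2 * (B' * B₁ * θ)) * (w y * g.len y * v y') * Real.exp (-(ρ * g.dist y y')) *
          bA.loc y' (bA.cut y' A) := h
    _ ≤ _ := mul_le_mul_of_nonneg_left (bA.loc_cut_le y' A) hK

end Display

/-! ## §3 The display with the `Δ⁽²⁾` factor CONCRETE (`Δ⁽²⁾ = delta2 calC` of FILE 74) -/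

section Concrete

open NormedSpace Finset Metric Filter
open B7Prop1Explicit B7Prop1Local B7Prop2Explicit B7Prop3Flat B7Prop4Flat B7Eq92Concrete B7Prop3GeneralLinear
  B7Prop4GeneralLevels B7Prop5GeneralOperators B7Prop5GeneralInduction B7Prop5GeneralLevels B7Ineq149Pairing B7Eq136SecondOrder
  B9Ineq3137From149 B9Eq3134MatrixConcrete

variable {d : ℕ}
variable {𝔸 : Type*} [NormedRing 𝔸] [NormedAlgebra ℂ 𝔸] [CompleteSpace 𝔸] [NormOneClass 𝔸]

variable (L : ℕ) (hL : 2 ≤ L) {G : Subgroup 𝔸ˣ} (hG : AvgClosed d L G) (k : ℕ)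
  (U₀ : B7Prop1Explicit.Site d → Fin d → 𝔸ˣ) (hU₀ : ∀ x κ, U₀ x κ ∈ G) {α₀ : ℝ} (hα : 0 < α₀)
  (hα3 : C0 d * α₀ ≤ 1 / 3) (hα4 : 4 * α₀ ≤ c2' d L) (h52 : pdev U₀ < α₀ * (((L : ℝ) ^ k)⁻¹) ^ 2)
  {b : ℝ} (hb : 0 < b)
  (hsmall : Real.exp (4 * (800 * ((d : ℝ) + 1) ^ 2 * ((d : ℝ) + 4)) * α₀)
    * (1 + 8 * (131072 * ((d : ℝ) + 1) ^ 2) * ((L : ℝ) ^ k * b)) ≤ 2)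
  (hc₃ : 4 * ((L : ℝ) ^ k * b) < c3 d L)
  (h145 : 8 * d * thetaGen d L α₀ * (L : ℝ)⁻¹ ^ 4 ≤ 1)
  (h155 : (2 * (L : ℝ) - 1) * (L : ℝ)⁻¹ ^ 2 + 2 * d * thetaGen d L α₀ * (L : ℝ)⁻¹ ^ 3
    + 1 / 8 * (1 + 2 * d * thetaGen d L α₀ * (L : ℝ)⁻¹ ^ 2 + 2 * d * C3Gen d L * ((L : ℝ) ^ k * b)) * (L : ℝ)⁻¹ ^ 2 ≤ 1)
  (S : Finset (B7Prop1Explicit.Site d × Fin d))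
  (lv : Finset ℕ) (T : ℕ → Finset (B7Prop1Explicit.Site d × Fin d)) (w : ℕ → B7Prop1Explicit.Site d × Fin d → ℝ)
  (K : ℕ → B7Prop1Explicit.Site d × Fin d → 𝔸)

variable {ι : Type} [Fintype ι] (e : ι → 𝔸) (τ : 𝔸 →L[ℝ] ℝ)
variable {g : B6.Geometry} (blk : S × ι → g.Site)
variable {P H : Type} [AddCommGroup P] [Module ℝ P] [AddCommGroup H] [Module ℝ H]

include hL hG hU₀ hα hα3 hα4 h52 hb hsmall hc₃ h145 h155 in
/-- **THE p. 423 DISPLAY WITH `Δ⁽²⁾` CONCRETE**: for the realised `Δ⁽²⁾ = delta2 calC` of FILE 74 (regime of `B7Eq136SecondOrder` verbatim,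
`(H*J)`-budget `w_j(c)‖K_j(c)‖ ≦ c₀Mα₀(Lʲ)^{d−2}` with `2 ≦ d`, `‖e_i‖ ≦ M_e`, box range `R` on the block map `blk` as in FILE 74 §7) on the
sharp-block sup sizes of the real coordinates, and the two letters `ζ∇G₀D : bP → bH` (`B′w(y)e^{−δ₁d}`, (3.45) for `G₀`), `RG′D\* : sup → bP`
(`B₁(L^{j₁}η)e^{−δ₁d}`, (3.43)/(3.42)₃ for `G′` after `R`), the composite `ζ∇G₀DRG′D\*Δ⁽²⁾` has the majorant
`[κ_P·L·c²·B′B₁·θ_Δe^{δ₁R}]·w(y)(Lʲη)·e^{−ρd(y,y′)}`, `θ_Δ = [2dC₃‖τ‖(Σ_i‖e_i‖)M_e c₀·#lv]·(Mα₀)` — print's `…O(1)Mα₀…` with the `Δ⁽²⁾` factor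
discharged (its weight `(L^{j′}η)^{−2}` absorbed in the flat carrier's units, scope (ii)) — for every `ρ ≧ 0` with `ρ + 2σ + αδ₀ ≦ δ₁`.
[cite: Balaban1985BackgroundPropagators, p.423 (display after (3.138)), (3.137) p.423, (3.43)/(3.45) p.398]
[cite: Balaban1984PropagatorsII, (2.51)–(2.55) p.232, Lemma 2.1 (2.60)–(2.61) p.234] [cite: Balaban1985Averaging, (149) p.40] -/
theorem firstFactors_concrete (hd : 2 ≤ d) (hJ : ∀ j ∈ lv, j ≤ k) (hw : ∀ j ∈ lv, ∀ c ∈ T j, 0 ≤ w j c)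
    {c₀ M Me : ℝ} (hc₀ : 0 ≤ c₀ * M) (hMe : 0 ≤ Me) (he : ∀ i, ‖e i‖ ≤ Me)
    (hK : ∀ j ∈ lv, ∀ c ∈ T j, w j c * ‖K j c‖ ≤ c₀ * M * α₀ * ((L : ℝ) ^ j) ^ (d - 2))
    {R : ℝ} {δ₀ α δ₁ ρ σ cr B' B₁ : ℝ} {wt : g.Site → ℝ}
    (hR : ∀ j ∈ lv, ∀ c ∈ T j, ∀ y y' : g.Site, BoxMeets L S blk j c y → BoxMeets L S blk j c y' → g.dist y y' ≤ R)
    (htri : B6RandomWalk.Triangle254 g) (hdist : ∀ y y' : g.Site, 0 ≤ g.dist y y') (hrow : RowSum g σ cr) (hcr : 0 ≤ cr)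
    (h260 : Ineq260 g δ₀ α) (hαδ : 0 ≤ α * δ₀) (hgL : 1 ≤ g.L) (hη : 0 < g.eta) (hRM : Real.log g.L ≤ α * δ₀ * g.R * g.M)
    (hB' : 0 ≤ B') (hB₁ : 0 ≤ B₁) (hwt : ∀ y, 0 ≤ wt y) (hρ : 0 ≤ ρ) (hσ : 0 ≤ σ) (hρδ : ρ + 2 * σ + α * δ₀ ≤ δ₁)
    {bP : BlockNorm g P} {bH : BlockNorm g H} {RGDs : (S × ι → ℝ) →ₗ[ℝ] P} {GzD : P →ₗ[ℝ] H}
    (hGD : HasMaj bP bH GzD (fun y y₁ => B' * wt y * Real.exp (-(δ₁ * g.dist y y₁))))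
    (hRG : HasMaj (BlockNorm.ofBlocks g blk) bP RGDs (fun y₁ y₂ => B₁ * g.len y₁ * Real.exp (-(δ₁ * g.dist y₁ y₂)))) :
    HasMaj (BlockNorm.ofBlocks g blk) bH
      (GzD ∘ₗ (RGDs ∘ₗ Matrix.mulVecLin (B9Delta2Def134.delta2 (calC L U₀ S lv T w K e τ))))
      (fun y y' => (bP.κ * g.L * cr ^ 2 * (B' * B₁ *
          ((2 * d * C3Gen d L * ‖τ‖ * (∑ i, ‖e i‖) * Me * c₀ * lv.card) * (M * α₀) * Real.exp (δ₁ * R)))) *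
        (wt y * g.len y) * Real.exp (-(ρ * g.dist y y'))) := by
  have hδ₁ : 0 ≤ δ₁ := by linarith
  -- FILE 74 §7: the concrete `Δ⁽²⁾` at the rate `δ₁`, read with the trivial weight `v ≡ 1`
  have hΔ2 := hasMaj_delta2_calC_exp L hL hG k U₀ hU₀ hα hα3 hα4 h52 hb hsmall hc₃ h145 h155 S lv T w K e τ blk hd hJ hw hc₀
    hMe he hK hδ₁ hR
  have hE : 0 ≤ ∑ i, ‖e i‖ := Finset.sum_nonneg fun i _ => norm_nonneg _
  have hC := C3Gen_nonneg d L
  have hθ : 0 ≤ (2 * d * C3Gen d L * ‖τ‖ * (∑ i, ‖e i‖) * Me * c₀ * lv.card) * (M * α₀) * Real.exp (δ₁ * R) := by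
    rw [show (2 * d * C3Gen d L * ‖τ‖ * (∑ i, ‖e i‖) * Me * c₀ * lv.card) * (M * α₀) * Real.exp (δ₁ * R) =
        2 * d * C3Gen d L * ‖τ‖ * (∑ i, ‖e i‖) * Me * lv.card * (c₀ * M * α₀) * Real.exp (δ₁ * R) by ring]
    have : 0 ≤ c₀ * M * α₀ := mul_nonneg hc₀ hα.le
    positivity
  have hΔ2' : HasMaj (BlockNorm.ofBlocks g blk) (BlockNorm.ofBlocks g blk)
      (Matrix.mulVecLin (B9Delta2Def134.delta2 (calC L U₀ S lv T w K e τ)))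
      (fun y₂ y' => ((2 * d * C3Gen d L * ‖τ‖ * (∑ i, ‖e i‖) * Me * c₀ * lv.card) * (M * α₀) * Real.exp (δ₁ * R)) *
        (1 : ℝ) * Real.exp (-(δ₁ * g.dist y₂ y'))) :=
    hΔ2.mono fun y₂ y' => le_of_eq (by ring)
  have h := firstFactors (bA := BlockNorm.ofBlocks g blk) (v := fun _ => (1 : ℝ)) htri hdist hrow hcr h260 hαδ hgL hη hRM hB' hB₁ hθ
    hwt (fun _ => zero_le_one) hρ hσ hρδ hGD hRG hΔ2'
  refine h.mono fun y y' => le_of_eq ?_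
  rw [show (BlockNorm.ofBlocks g blk).κ = (1 : ℝ) from rfl]
  ring

end Concrete

end Literature.MathematicalPhysics.QuantumFieldTheory.Balaban1983to89.B9Eq3138FirstFactors

end
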